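import Summits.QuantumFields.BalabanUV.Beta.GAN24.ThreeFaceUnrollSrec
import Summits.QuantumFields.BalabanUV.Beta.GAN24.SpureRecLegChargeThreeFace
import Summits.QuantumFields.BalabanUV.Beta.GAN24.LambdaPieceThreeFace
import Summits.QuantumFields.BalabanUV.Beta.GAN24.WilsonThreeFaceGraded

/-!
# `BalabanUV.Beta.GAN24.ThreeFaceRecOfLetters` — binder row G-an2-4 ∕ (CONV-C), W-slot CT-W, route «WC-TL», table fact «3F-REC» ∕ «S3C-REC» (PRICING Q-S3C):
# **«3F-REC» (hence «S3C-REC» every member, hence — with (C)sym, (Q-D), (Q-D-rate) — the D1 literal) FROM ONE FINITE FACE LETTER**: the cubic-Wilson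
# three-face law (T-W)_face at exit-face periods `Lc^{k+1}` (the Λ-piece letter (T-H)_face being the theorem `LambdaPieceThreeFace`; the generic two-letter
# form — level-0 letter (T-0)_face + (T-H)_face — is kept as the first section)

NOT IN PRINT; OUR BOOKKEEPING ([folklore] induction bookkeeping BY NAME over `ThreeFaceUnrollSrec.threeFace_SrecAt_succ_unroll` and
`SpureRecLegChargeThreeFace`; G-an2-4 formalisation swarm, leaf prover `b2b-balaban-gan24-formalise-leaf-04`, gen 62).  HONEST FRAMING (cell contract, verbatim):
«discharging `BetaPertH` makes Bałaban's UV stability UNCONDITIONAL — a real constructive-QFT result; it is NOT the continuum limit and NOT the Clay problem.»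
HONEST DEPENDENCY (verbatim): «continuum YM on T⁴ ⇐ BetaPertH ∧ nine spine estimates (0/9 proved); BetaPertH ⇐ (D1) ∧ (D4) ∧ CAP+tail; G-an2-4 gates asym, D1
and NE2/3/4.»

WHAT ([folklore]; 0 `def`, 0 cited facts, 0 `def … : Prop`, 0 sorry): **`threeFace_rec_of_letters`** (generic `d`; induction on the level with the exit-face period
multiplied by `Lc` at each step), `threeFace_rec_Lc_of_letters` (= the hypothesis `h3F` of `SpureRecLegChargeThreeFace`), **`hasSum_unitS_SpureRecAt_of_letters`**
(«S3C-REC» every member, every `(j, sf, sm, κ, a, b, s)`), (the d = 3 D1-literal capstones live in the sequel `ThreeFaceRecLiteral`); then, with `LambdaPieceThreeFace` ((T-H)_face at every level and at level 0): **`threeFace_SrecAt_zero_of_wilsonFace`** ((T-0)_face ⟸ (T-W)_face: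
split of `S0NAt`, border off the ff block, Λ₀ by `threeFace_SLam_lamCoeffOf_eq_zero`), **`threeFace_rec_of_wilsonFace`**, **`hasSum_unitS_SpureRecAt_of_wilsonFace`**
(«S3C-REC» EVERY MEMBER ⟸ (T-W)_face ALONE);
and, with `WilsonThreeFaceGraded` ((T-W)_face ⟸ the finite graded identity (W-face), `3 ≤ Lc`): **`threeFace_rec_of_gradedWilson`**,
**`hasSum_unitS_SpureRecAt_of_gradedWilson`** («S3C-REC» EVERY MEMBER ⟸ (W-face) — ONE decidable identity of an3's cubic Wilson table).
THE LETTERS (hypotheses, DISPLAYED, NOT PROVED here; (T-H)_face IS proved in `LambdaPieceThreeFace`): (T-0)_face `h0` — for every period `P = Lc^{k+1}` and all `(γ, α, β)`,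
`Σ_{v ∈ box P} [v_γ % P = P−1]·Σ'_{(y,w)} [y_α % P = P−1][w_β % P = P−1]·SrecAt … 0 γ v y w (inl α)(inl β) = 0` (`SrecAt … 0 = S0NAt …`: the cubic Wilson table —
its three-face law is EXACT in rationals at D = 2,3,4 for all period triples ≤ 27, engine R-leaf04-g62-2∕2b — plus the level-0 border (off ff) and Λ₀ parts);
(T-H)_face `hΛ` — for every level `j`, period `P = Lc^{k+1}` and `(γ, α, β)`, the same form of `SLam Lc (lamCoeffK (KInvStep Lc (j+1)) (E2 d Lc (j+1)) Lc) hessFFAt` vanishes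
(a THEOREM: `LambdaPieceThreeFace.threeFace_SLam_lamCoeffK_eq_zero`); (T-W)_face `hW` — the same form of the cubic Wilson table `wilsonA d` alone (EXACT in rationals
at D = 2,3,4; ⟸ four offset-graded colour-block sums over `WilsonIdx`, Q-leaf04-g62-2).  CONDITIONAL on the displayed hypotheses; asserts NO value of Bałaban's tables; discharges NOTHING of
(T-0)_face ∕ (T-H)_face ∕ (C)sym ∕ (Q-D) ∕ (Q-D-rate) ∕ «T2Shape» ∕ «T2Drift» ∕ (hW, hWall); NOT «D1 closed»; NEVER «G-an2-4 closed» as (CONV-C); NOT D1, NOT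
`BetaPertH`, NOT continuum, NOT Clay.  2026-08-22; no existing file touched.
-/

noncomputable section

open Finset
open scoped BigOperators
open Literature.MathematicalPhysics.QuantumFieldTheory
open Literature.MathematicalPhysics.QuantumFieldTheory.Balaban1983to89
open Literature.MathematicalPhysics.QuantumFieldTheory.Balaban1983to89.Beta
open ExpKernelCalculus (Site MKer)
open AffineAveraging (box toSite)
open OneStepResolventKernel (Fib)
open OneStepKernelFamily (KInvStep TbalOf)
open BalabanStepJetsSucc (lamCoeffK E2)
open InterLevelTransport (SLam)
open AveragingHessianKernelsRooted (hessFFAt)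
open Summit.QuantumFields.BalabanUV.Beta.HessKerDressedUnits (unitS)
open Summit.QuantumFields.BalabanUV.Beta.WardLocusRecursive (SrecAt)
open Summit.QuantumFields.BalabanUV.Beta.SpineRooted (SpureRecAt T2RecOf T2RecAt M1At)
open Summit.QuantumFields.BalabanUV.Beta.SecondOrderUnits (unitS₂)
open Summit.QuantumFields.BalabanUV.Beta.GAN24.CombesThomas (sfStep smStep)
open Summit.QuantumFields.BalabanUV.Beta.GAN24.BiStencilZeroMode (Tab zmode)
open AveragingMixedJetTables (mixFFAt)
open BalabanCompositeJets (LocStencil₂)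
open RemainderConstAllScales (AllScalesSeq)
open AveragingContoursRooted (ctrOff ctrOff_mem_box)
open WilsonVertex2Sym (wsym22)
open Summit.QuantumFields.BalabanUV.Beta.AxialDressingRooted (dressKBmAt coProjBmAtK)
open Summit.QuantumFields.BalabanUV.Beta.SecondOrderSocketIdentification (vh₂SAn1)
open Summit.QuantumFields.BalabanUV.Beta.RowD1JointEnd (JsRowD1Pin)

namespace Summit.QuantumFields.BalabanUV.Beta.GAN24.ThreeFaceRecOfLetters

open Summit.QuantumFields.BalabanUV.Beta.GAN24.ThreeFaceUnrollSrec (threeFace_SrecAt_succ_unroll)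
open Summit.QuantumFields.BalabanUV.Beta.GAN24.SpureRecLegChargeThreeFace (hasSum_unitS_SpureRecAt_of_threeFace exists_allScalesSeq_JsRowD1Pin_of_threeFace_C_QD)
open Summit.QuantumFields.BalabanUV.Beta.SpineRooted (S0NAt)
open BalabanStepJets (box1)
open Summit.QuantumFields.BalabanUV.Beta.WardLocusRecursive (SrecAt_zero)
open StepJetData (wilsonA wBound locStencil_wilsonA)
open BalabanStepJets (lamCoeffOf abs_lamCoeffOf_le)
open OneStepResolventKernel (KInv LocStencil decays_KInv)
open AveragingHessianKernels (ell packVH_inl_inl)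
open AveragingHessianKernelsRooted (biLoc_hessFFAt)
open InterLevelTransport (locStencil_SLam)
open ExpKernelCalculus (VertexFamily)

variable {d : ℕ} {Lc : ℕ} [NeZero Lc]

section General

variable {r : Fin (d + 1) → ℕ}

/-- NOT IN PRINT; OUR BOOKKEEPING.  **«3F-REC» AT EVERY LEVEL AND EVERY EXIT-FACE PERIOD FROM THE TWO FACE LETTERS**: if the three-face-legs cell forms of the
level-0 table `SrecAt … 0 = S0NAt …` vanish for every exit-face period `Lc^{k+1}`, `k ≥ 0` (letter (T-0)_face: the cubic Wilson part — EXACT in rationals at D = 2,3,4 — and the level-0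
Λ-part), and those of the Λ-pieces `SLam Lc (lamCoeffK (KInvStep Lc (j+1)) (E2 d Lc (j+1)) Lc) hessFFAt` vanish at every level and every such period (letter (T-H)_face), then
the three-face-legs cell form of EVERY folded member `SrecAt … j` vanishes for EVERY period `Lc^{k+1}` — induction on `j` with the period multiplied by `Lc` at each step
(`ThreeFaceUnrollSrec.threeFace_SrecAt_succ_unroll`). -/
theorem threeFace_rec_of_letters (hLc : 1 ≤ Lc) (hr : r ∈ box (d + 1) Lc) (cE cVH cΛ : ℝ)
    (h0 : ∀ (k : ℕ) (γ α β : Fin (d + 1)),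
      ∑ v ∈ box (d + 1) (Lc ^ (k + 1)), (if toSite v γ % ((Lc ^ (k + 1) : ℕ) : ℤ) = ((Lc ^ (k + 1) : ℕ) : ℤ) - 1 then (1 : ℝ) else 0) *
          ∑' yw : Site (d + 1) × Site (d + 1),
            (if yw.1 α % ((Lc ^ (k + 1) : ℕ) : ℤ) = ((Lc ^ (k + 1) : ℕ) : ℤ) - 1 then (1 : ℝ) else 0) *
              (if yw.2 β % ((Lc ^ (k + 1) : ℕ) : ℤ) = ((Lc ^ (k + 1) : ℕ) : ℤ) - 1 then (1 : ℝ) else 0) *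
              SrecAt d Lc (toSite r) cE cVH cΛ 0 γ (toSite v) yw.1 yw.2 (Sum.inl α) (Sum.inl β) = 0)
    (hΛ : ∀ (j : ℕ) (k : ℕ) (γ α β : Fin (d + 1)),
      ∑ v ∈ box (d + 1) (Lc ^ (k + 1)), (if toSite v γ % ((Lc ^ (k + 1) : ℕ) : ℤ) = ((Lc ^ (k + 1) : ℕ) : ℤ) - 1 then (1 : ℝ) else 0) *
          ∑' yw : Site (d + 1) × Site (d + 1),
            (if yw.1 α % ((Lc ^ (k + 1) : ℕ) : ℤ) = ((Lc ^ (k + 1) : ℕ) : ℤ) - 1 then (1 : ℝ) else 0) *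
              (if yw.2 β % ((Lc ^ (k + 1) : ℕ) : ℤ) = ((Lc ^ (k + 1) : ℕ) : ℤ) - 1 then (1 : ℝ) else 0) *
              SLam Lc (lamCoeffK (KInvStep (d := d) Lc (j + 1)) (E2 d Lc (j + 1)) Lc) (fun μ y => hessFFAt (toSite r) Lc μ y)
                γ (toSite v) yw.1 yw.2 (Sum.inl α) (Sum.inl β) = 0)
    (j : ℕ) (k : ℕ) (γ α β : Fin (d + 1)) :
    ∑ v ∈ box (d + 1) (Lc ^ (k + 1)), (if toSite v γ % ((Lc ^ (k + 1) : ℕ) : ℤ) = ((Lc ^ (k + 1) : ℕ) : ℤ) - 1 then (1 : ℝ) else 0) *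
        ∑' yw : Site (d + 1) × Site (d + 1),
          (if yw.1 α % ((Lc ^ (k + 1) : ℕ) : ℤ) = ((Lc ^ (k + 1) : ℕ) : ℤ) - 1 then (1 : ℝ) else 0) *
            (if yw.2 β % ((Lc ^ (k + 1) : ℕ) : ℤ) = ((Lc ^ (k + 1) : ℕ) : ℤ) - 1 then (1 : ℝ) else 0) *
            SrecAt d Lc (toSite r) cE cVH cΛ j γ (toSite v) yw.1 yw.2 (Sum.inl α) (Sum.inl β) = 0 := by
  induction j generalizing k γ α β with
  | zero => exact h0 k γ α β
  | succ j ih =>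
    haveI : NeZero (Lc ^ (k + 1)) := ⟨pow_ne_zero _ (NeZero.ne Lc)⟩
    have e : Lc * Lc ^ (k + 1) = Lc ^ (k + 1 + 1) := (pow_succ' Lc (k + 1)).symm
    rw [threeFace_SrecAt_succ_unroll hLc hr cE cVH cΛ j γ α β (Lc ^ (k + 1)), e, ih (k + 1) γ α β, hΛ j k γ α β]
    ring

/-- NOT IN PRINT; OUR BOOKKEEPING.  **«3F-REC» (the hypothesis `h3F` of `SpureRecLegChargeThreeFace`, period `Lc`) FROM THE TWO FACE LETTERS.** -/
theorem threeFace_rec_Lc_of_letters (hLc : 1 ≤ Lc) (hr : r ∈ box (d + 1) Lc) (cE cVH cΛ : ℝ)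
    (h0 : ∀ (k : ℕ) (γ α β : Fin (d + 1)),
      ∑ v ∈ box (d + 1) (Lc ^ (k + 1)), (if toSite v γ % ((Lc ^ (k + 1) : ℕ) : ℤ) = ((Lc ^ (k + 1) : ℕ) : ℤ) - 1 then (1 : ℝ) else 0) *
          ∑' yw : Site (d + 1) × Site (d + 1),
            (if yw.1 α % ((Lc ^ (k + 1) : ℕ) : ℤ) = ((Lc ^ (k + 1) : ℕ) : ℤ) - 1 then (1 : ℝ) else 0) *
              (if yw.2 β % ((Lc ^ (k + 1) : ℕ) : ℤ) = ((Lc ^ (k + 1) : ℕ) : ℤ) - 1 then (1 : ℝ) else 0) *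
              SrecAt d Lc (toSite r) cE cVH cΛ 0 γ (toSite v) yw.1 yw.2 (Sum.inl α) (Sum.inl β) = 0)
    (hΛ : ∀ (j : ℕ) (k : ℕ) (γ α β : Fin (d + 1)),
      ∑ v ∈ box (d + 1) (Lc ^ (k + 1)), (if toSite v γ % ((Lc ^ (k + 1) : ℕ) : ℤ) = ((Lc ^ (k + 1) : ℕ) : ℤ) - 1 then (1 : ℝ) else 0) *
          ∑' yw : Site (d + 1) × Site (d + 1),
            (if yw.1 α % ((Lc ^ (k + 1) : ℕ) : ℤ) = ((Lc ^ (k + 1) : ℕ) : ℤ) - 1 then (1 : ℝ) else 0) *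
              (if yw.2 β % ((Lc ^ (k + 1) : ℕ) : ℤ) = ((Lc ^ (k + 1) : ℕ) : ℤ) - 1 then (1 : ℝ) else 0) *
              SLam Lc (lamCoeffK (KInvStep (d := d) Lc (j + 1)) (E2 d Lc (j + 1)) Lc) (fun μ y => hessFFAt (toSite r) Lc μ y)
                γ (toSite v) yw.1 yw.2 (Sum.inl α) (Sum.inl β) = 0)
    (j : ℕ) (γ α β : Fin (d + 1)) :
    ∑ v ∈ box (d + 1) Lc, (if toSite v γ % (Lc : ℤ) = (Lc : ℤ) - 1 then (1 : ℝ) else 0) *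
        ∑' yw : Site (d + 1) × Site (d + 1),
          (if yw.1 α % (Lc : ℤ) = (Lc : ℤ) - 1 then (1 : ℝ) else 0) * (if yw.2 β % (Lc : ℤ) = (Lc : ℤ) - 1 then (1 : ℝ) else 0) *
            SrecAt d Lc (toSite r) cE cVH cΛ j γ (toSite v) yw.1 yw.2 (Sum.inl α) (Sum.inl β) = 0 := by
  have h := threeFace_rec_of_letters hLc hr cE cVH cΛ h0 hΛ j 0 γ α β
  simpa only [zero_add, pow_one] using h

/-- NOT IN PRINT; OUR BOOKKEEPING.  **«S3C-REC» (every member, with values) FROM THE TWO FACE LETTERS** (`hasSum_unitS_SpureRecAt_of_threeFace` ∘ the above). -/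
theorem hasSum_unitS_SpureRecAt_of_letters (hLc : 1 ≤ Lc) (hr : r ∈ box (d + 1) Lc) (cE cVH cΛ : ℝ)
    (h0 : ∀ (k : ℕ) (γ α β : Fin (d + 1)),
      ∑ v ∈ box (d + 1) (Lc ^ (k + 1)), (if toSite v γ % ((Lc ^ (k + 1) : ℕ) : ℤ) = ((Lc ^ (k + 1) : ℕ) : ℤ) - 1 then (1 : ℝ) else 0) *
          ∑' yw : Site (d + 1) × Site (d + 1),
            (if yw.1 α % ((Lc ^ (k + 1) : ℕ) : ℤ) = ((Lc ^ (k + 1) : ℕ) : ℤ) - 1 then (1 : ℝ) else 0) *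
              (if yw.2 β % ((Lc ^ (k + 1) : ℕ) : ℤ) = ((Lc ^ (k + 1) : ℕ) : ℤ) - 1 then (1 : ℝ) else 0) *
              SrecAt d Lc (toSite r) cE cVH cΛ 0 γ (toSite v) yw.1 yw.2 (Sum.inl α) (Sum.inl β) = 0)
    (hΛ : ∀ (j : ℕ) (k : ℕ) (γ α β : Fin (d + 1)),
      ∑ v ∈ box (d + 1) (Lc ^ (k + 1)), (if toSite v γ % ((Lc ^ (k + 1) : ℕ) : ℤ) = ((Lc ^ (k + 1) : ℕ) : ℤ) - 1 then (1 : ℝ) else 0) *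
          ∑' yw : Site (d + 1) × Site (d + 1),
            (if yw.1 α % ((Lc ^ (k + 1) : ℕ) : ℤ) = ((Lc ^ (k + 1) : ℕ) : ℤ) - 1 then (1 : ℝ) else 0) *
              (if yw.2 β % ((Lc ^ (k + 1) : ℕ) : ℤ) = ((Lc ^ (k + 1) : ℕ) : ℤ) - 1 then (1 : ℝ) else 0) *
              SLam Lc (lamCoeffK (KInvStep (d := d) Lc (j + 1)) (E2 d Lc (j + 1)) Lc) (fun μ y => hessFFAt (toSite r) Lc μ y)
                γ (toSite v) yw.1 yw.2 (Sum.inl α) (Sum.inl β) = 0)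
    (j : ℕ) (sf sm : ℝ) (κ a b : Fin (d + 1)) (s : Site (d + 1)) :
    HasSum (fun p : Site (d + 1) × Site (d + 1) =>
        unitS sf sm (SpureRecAt d Lc (toSite r) cE cVH cΛ j) κ s p.1 p.2 (Sum.inl a) (Sum.inl b)) 0 ∧
      HasSum (fun p : Site (d + 1) × Site (d + 1) =>
        unitS sf sm (SpureRecAt d Lc (toSite r) cE cVH cΛ j) κ p.1 p.2 s (Sum.inl a) (Sum.inl b)) 0 ∧
      HasSum (fun p : Site (d + 1) × Site (d + 1) =>
        unitS sf sm (SpureRecAt d Lc (toSite r) cE cVH cΛ j) κ p.1 s p.2 (Sum.inl a) (Sum.inl b)) 0 :=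
  hasSum_unitS_SpureRecAt_of_threeFace hLc hr cE cVH cΛ (threeFace_rec_Lc_of_letters hLc hr cE cVH cΛ h0 hΛ) j sf sm κ a b s

end General


/-! ## The level-0 letter from the cubic-Wilson face law alone ((T-H)_face is `LambdaPieceThreeFace`) -/

section Wilson

variable {r : Fin (d + 1) → ℕ}

/-- NOT IN PRINT; OUR BOOKKEEPING.  **(T-0)_face FROM (T-W)_face**: the three-face-legs cell form (period `Lc^{k+1}`) of the level-0 table `SrecAt … 0 = S0NAt …`
splits along `S0NAt = cE•wilsonA + cVH•vhSAt + cΛ•SLam Lc (lamCoeffOf (KInv Lc) Lc) hessFFAt`: the border is OFF the ff block (`packVH_inl_inl`), the Λ₀-piece's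
form vanishes (`LambdaPieceThreeFace.threeFace_SLam_lamCoeffOf_eq_zero`), the cubic Wilson table's form is the letter (T-W)_face `hW`. -/
theorem threeFace_SrecAt_zero_of_wilsonFace (hLc : 1 ≤ Lc) (hr : r ∈ box (d + 1) Lc) (cE cVH cΛ : ℝ)
    (hW : ∀ (k : ℕ) (γ α β : Fin (d + 1)),
      ∑ v ∈ box (d + 1) (Lc ^ (k + 1)), (if toSite v γ % ((Lc ^ (k + 1) : ℕ) : ℤ) = ((Lc ^ (k + 1) : ℕ) : ℤ) - 1 then (1 : ℝ) else 0) *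
        ∑' yw : Site (d + 1) × Site (d + 1),
          (if yw.1 α % ((Lc ^ (k + 1) : ℕ) : ℤ) = ((Lc ^ (k + 1) : ℕ) : ℤ) - 1 then (1 : ℝ) else 0) *
            (if yw.2 β % ((Lc ^ (k + 1) : ℕ) : ℤ) = ((Lc ^ (k + 1) : ℕ) : ℤ) - 1 then (1 : ℝ) else 0) *
            wilsonA d γ (toSite v) yw.1 yw.2 (Sum.inl α) (Sum.inl β) = 0)
    (k : ℕ) (γ α β : Fin (d + 1)) :
    ∑ v ∈ box (d + 1) (Lc ^ (k + 1)), (if toSite v γ % ((Lc ^ (k + 1) : ℕ) : ℤ) = ((Lc ^ (k + 1) : ℕ) : ℤ) - 1 then (1 : ℝ) else 0) *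
        ∑' yw : Site (d + 1) × Site (d + 1),
          (if yw.1 α % ((Lc ^ (k + 1) : ℕ) : ℤ) = ((Lc ^ (k + 1) : ℕ) : ℤ) - 1 then (1 : ℝ) else 0) *
            (if yw.2 β % ((Lc ^ (k + 1) : ℕ) : ℤ) = ((Lc ^ (k + 1) : ℕ) : ℤ) - 1 then (1 : ℝ) else 0) *
            SrecAt d Lc (toSite r) cE cVH cΛ 0 γ (toSite v) yw.1 yw.2 (Sum.inl α) (Sum.inl β) = 0 := by
  haveI : NeZero Lc := ⟨by omega⟩
  set w2 : Site (d + 1) × Site (d + 1) → ℝ := fun yw =>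
    (if yw.1 α % ((Lc ^ (k + 1) : ℕ) : ℤ) = ((Lc ^ (k + 1) : ℕ) : ℤ) - 1 then (1 : ℝ) else 0) * (if yw.2 β % ((Lc ^ (k + 1) : ℕ) : ℤ) = ((Lc ^ (k + 1) : ℕ) : ℤ) - 1 then (1 : ℝ) else 0) with hw2
  have hw2b : ∀ yw, |w2 yw| ≤ 1 := by
    intro yw; simp only [hw2]; split_ifs <;> simp
  -- local-stencil data: the cubic Wilson table and the level-0 Λ-piece
  obtain ⟨δ₀, C, hδ₀, hC, hdec⟩ := decays_KInv (N := Lc) (d := d)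
  have hδ2 : (0 : ℝ) ≤ δ₀ / 2 := by positivity
  have h1 : LocStencil (wilsonA d) (wBound d * Real.exp (4 * (δ₀ / 2))) (δ₀ / 2) := locStencil_wilsonA hδ2
  have hc := abs_lamCoeffOf_le (N := Lc) hdec hC hδ₀.le
  have hQ : VertexFamily (fun μ y => hessFFAt (toSite r) Lc μ y) Lc
      (2 * (ell (d + 1) Lc : ℝ) ^ 2 * Real.exp (4 * ((d : ℝ) + 1) * Lc * δ₀)) δ₀ :=
    fun μ y => biLoc_hessFFAt hLc μ y hr hδ₀.le
  have h3 := locStencil_SLam (N := Lc) hc hQ hδ₀ (mul_nonneg (mul_nonneg (by positivity) hC) (Real.exp_pos _).le)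
  have key : ∀ v : Fin (d + 1) → ℕ,
      (∑' yw : Site (d + 1) × Site (d + 1), w2 yw * SrecAt d Lc (toSite r) cE cVH cΛ 0 γ (toSite v) yw.1 yw.2 (Sum.inl α) (Sum.inl β))
        = cE * (∑' yw : Site (d + 1) × Site (d + 1), w2 yw * wilsonA d γ (toSite v) yw.1 yw.2 (Sum.inl α) (Sum.inl β))
          + cΛ * (∑' yw : Site (d + 1) × Site (d + 1),
            w2 yw * SLam Lc (lamCoeffOf (KInv (N := Lc) (d := d)) Lc) (fun μ y => hessFFAt (toSite r) Lc μ y)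
              γ (toSite v) yw.1 yw.2 (Sum.inl α) (Sum.inl β)) := by
    intro v
    have hsW := LambdaPieceThreeFace.summable_weighted_pairs (h1 γ (toSite v)) (by positivity) (Sum.inl α) (Sum.inl β) w2 hw2b
    have hsL := LambdaPieceThreeFace.summable_weighted_pairs (h3 γ (toSite v)) (by positivity) (Sum.inl α) (Sum.inl β) w2 hw2b
    have hpt : ∀ yw : Site (d + 1) × Site (d + 1),
        w2 yw * SrecAt d Lc (toSite r) cE cVH cΛ 0 γ (toSite v) yw.1 yw.2 (Sum.inl α) (Sum.inl β)
          = cE * (w2 yw * wilsonA d γ (toSite v) yw.1 yw.2 (Sum.inl α) (Sum.inl β))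
            + cΛ * (w2 yw * SLam Lc (lamCoeffOf (KInv (N := Lc) (d := d)) Lc) (fun μ y => hessFFAt (toSite r) Lc μ y)
              γ (toSite v) yw.1 yw.2 (Sum.inl α) (Sum.inl β)) := by
      intro yw
      rw [SrecAt_zero]
      simp only [S0NAt, Pi.add_apply, Pi.smul_apply, smul_eq_mul, AveragingHessianKernelsRooted.vhSAt, packVH_inl_inl, mul_zero, add_zero]
      ring
    rw [tsum_congr hpt, (hsW.mul_left cE).tsum_add (hsL.mul_left cΛ), tsum_mul_left, tsum_mul_left]
  have hU := LambdaPieceThreeFace.threeFace_SLam_lamCoeffOf_eq_zero (d := d) hLc hr k γ α β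
  have hWk := hW k γ α β
  simp only [hw2] at key
  rw [Finset.sum_congr rfl fun v _ => by rw [key v]]
  simp only [mul_add, Finset.sum_add_distrib]
  have e1 : ∑ v ∈ box (d + 1) (Lc ^ (k + 1)), (if toSite v γ % ((Lc ^ (k + 1) : ℕ) : ℤ) = ((Lc ^ (k + 1) : ℕ) : ℤ) - 1 then (1 : ℝ) else 0) *
      (cE * ∑' yw : Site (d + 1) × Site (d + 1),
        (if yw.1 α % ((Lc ^ (k + 1) : ℕ) : ℤ) = ((Lc ^ (k + 1) : ℕ) : ℤ) - 1 then (1 : ℝ) else 0) * (if yw.2 β % ((Lc ^ (k + 1) : ℕ) : ℤ) = ((Lc ^ (k + 1) : ℕ) : ℤ) - 1 then (1 : ℝ) else 0) *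
          wilsonA d γ (toSite v) yw.1 yw.2 (Sum.inl α) (Sum.inl β))
      = cE * ∑ v ∈ box (d + 1) (Lc ^ (k + 1)), (if toSite v γ % ((Lc ^ (k + 1) : ℕ) : ℤ) = ((Lc ^ (k + 1) : ℕ) : ℤ) - 1 then (1 : ℝ) else 0) *
        ∑' yw : Site (d + 1) × Site (d + 1),
          (if yw.1 α % ((Lc ^ (k + 1) : ℕ) : ℤ) = ((Lc ^ (k + 1) : ℕ) : ℤ) - 1 then (1 : ℝ) else 0) * (if yw.2 β % ((Lc ^ (k + 1) : ℕ) : ℤ) = ((Lc ^ (k + 1) : ℕ) : ℤ) - 1 then (1 : ℝ) else 0) *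
            wilsonA d γ (toSite v) yw.1 yw.2 (Sum.inl α) (Sum.inl β) := by
    rw [Finset.mul_sum]
    exact Finset.sum_congr rfl fun v _ => by ring
  have e2 : ∑ v ∈ box (d + 1) (Lc ^ (k + 1)), (if toSite v γ % ((Lc ^ (k + 1) : ℕ) : ℤ) = ((Lc ^ (k + 1) : ℕ) : ℤ) - 1 then (1 : ℝ) else 0) *
      (cΛ * ∑' yw : Site (d + 1) × Site (d + 1),
        (if yw.1 α % ((Lc ^ (k + 1) : ℕ) : ℤ) = ((Lc ^ (k + 1) : ℕ) : ℤ) - 1 then (1 : ℝ) else 0) * (if yw.2 β % ((Lc ^ (k + 1) : ℕ) : ℤ) = ((Lc ^ (k + 1) : ℕ) : ℤ) - 1 then (1 : ℝ) else 0) *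
          SLam Lc (lamCoeffOf (KInv (N := Lc) (d := d)) Lc) (fun μ y => hessFFAt (toSite r) Lc μ y)
            γ (toSite v) yw.1 yw.2 (Sum.inl α) (Sum.inl β))
      = cΛ * ∑ v ∈ box (d + 1) (Lc ^ (k + 1)), (if toSite v γ % ((Lc ^ (k + 1) : ℕ) : ℤ) = ((Lc ^ (k + 1) : ℕ) : ℤ) - 1 then (1 : ℝ) else 0) *
        ∑' yw : Site (d + 1) × Site (d + 1),
          (if yw.1 α % ((Lc ^ (k + 1) : ℕ) : ℤ) = ((Lc ^ (k + 1) : ℕ) : ℤ) - 1 then (1 : ℝ) else 0) * (if yw.2 β % ((Lc ^ (k + 1) : ℕ) : ℤ) = ((Lc ^ (k + 1) : ℕ) : ℤ) - 1 then (1 : ℝ) else 0) *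
            SLam Lc (lamCoeffOf (KInv (N := Lc) (d := d)) Lc) (fun μ y => hessFFAt (toSite r) Lc μ y)
              γ (toSite v) yw.1 yw.2 (Sum.inl α) (Sum.inl β) := by
    rw [Finset.mul_sum]
    exact Finset.sum_congr rfl fun v _ => by ring
  rw [e1, e2, hWk, hU, mul_zero, mul_zero, add_zero]

/-- NOT IN PRINT; OUR BOOKKEEPING.  **«3F-REC» AT EVERY LEVEL AND EVERY PERIOD `Lc^{k+1}` FROM THE CUBIC-WILSON FACE LAW ALONE.** -/
theorem threeFace_rec_of_wilsonFace (hLc : 1 ≤ Lc) (hr : r ∈ box (d + 1) Lc) (cE cVH cΛ : ℝ)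
    (hW : ∀ (k : ℕ) (γ α β : Fin (d + 1)),
      ∑ v ∈ box (d + 1) (Lc ^ (k + 1)), (if toSite v γ % ((Lc ^ (k + 1) : ℕ) : ℤ) = ((Lc ^ (k + 1) : ℕ) : ℤ) - 1 then (1 : ℝ) else 0) *
        ∑' yw : Site (d + 1) × Site (d + 1),
          (if yw.1 α % ((Lc ^ (k + 1) : ℕ) : ℤ) = ((Lc ^ (k + 1) : ℕ) : ℤ) - 1 then (1 : ℝ) else 0) *
            (if yw.2 β % ((Lc ^ (k + 1) : ℕ) : ℤ) = ((Lc ^ (k + 1) : ℕ) : ℤ) - 1 then (1 : ℝ) else 0) *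
            wilsonA d γ (toSite v) yw.1 yw.2 (Sum.inl α) (Sum.inl β) = 0)
    (j k : ℕ) (γ α β : Fin (d + 1)) :
    ∑ v ∈ box (d + 1) (Lc ^ (k + 1)), (if toSite v γ % ((Lc ^ (k + 1) : ℕ) : ℤ) = ((Lc ^ (k + 1) : ℕ) : ℤ) - 1 then (1 : ℝ) else 0) *
        ∑' yw : Site (d + 1) × Site (d + 1),
          (if yw.1 α % ((Lc ^ (k + 1) : ℕ) : ℤ) = ((Lc ^ (k + 1) : ℕ) : ℤ) - 1 then (1 : ℝ) else 0) *
            (if yw.2 β % ((Lc ^ (k + 1) : ℕ) : ℤ) = ((Lc ^ (k + 1) : ℕ) : ℤ) - 1 then (1 : ℝ) else 0) *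
            SrecAt d Lc (toSite r) cE cVH cΛ j γ (toSite v) yw.1 yw.2 (Sum.inl α) (Sum.inl β) = 0 :=
  haveI : NeZero Lc := ⟨by omega⟩
  threeFace_rec_of_letters hLc hr cE cVH cΛ (threeFace_SrecAt_zero_of_wilsonFace hLc hr cE cVH cΛ hW)
    (fun j k γ α β => LambdaPieceThreeFace.threeFace_SLam_lamCoeffK_eq_zero hLc hr j k γ α β) j k γ α β

/-- NOT IN PRINT; OUR BOOKKEEPING.  **«S3C-REC» (every member, with values) FROM THE CUBIC-WILSON FACE LAW ALONE.** -/
theorem hasSum_unitS_SpureRecAt_of_wilsonFace (hLc : 1 ≤ Lc) (hr : r ∈ box (d + 1) Lc) (cE cVH cΛ : ℝ)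
    (hW : ∀ (k : ℕ) (γ α β : Fin (d + 1)),
      ∑ v ∈ box (d + 1) (Lc ^ (k + 1)), (if toSite v γ % ((Lc ^ (k + 1) : ℕ) : ℤ) = ((Lc ^ (k + 1) : ℕ) : ℤ) - 1 then (1 : ℝ) else 0) *
        ∑' yw : Site (d + 1) × Site (d + 1),
          (if yw.1 α % ((Lc ^ (k + 1) : ℕ) : ℤ) = ((Lc ^ (k + 1) : ℕ) : ℤ) - 1 then (1 : ℝ) else 0) *
            (if yw.2 β % ((Lc ^ (k + 1) : ℕ) : ℤ) = ((Lc ^ (k + 1) : ℕ) : ℤ) - 1 then (1 : ℝ) else 0) *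
            wilsonA d γ (toSite v) yw.1 yw.2 (Sum.inl α) (Sum.inl β) = 0)
    (j : ℕ) (sf sm : ℝ) (κ a b : Fin (d + 1)) (s : Site (d + 1)) :
    HasSum (fun p : Site (d + 1) × Site (d + 1) =>
        unitS sf sm (SpureRecAt d Lc (toSite r) cE cVH cΛ j) κ s p.1 p.2 (Sum.inl a) (Sum.inl b)) 0 ∧
      HasSum (fun p : Site (d + 1) × Site (d + 1) =>
        unitS sf sm (SpureRecAt d Lc (toSite r) cE cVH cΛ j) κ p.1 p.2 s (Sum.inl a) (Sum.inl b)) 0 ∧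
      HasSum (fun p : Site (d + 1) × Site (d + 1) =>
        unitS sf sm (SpureRecAt d Lc (toSite r) cE cVH cΛ j) κ p.1 s p.2 (Sum.inl a) (Sum.inl b)) 0 :=
  haveI : NeZero Lc := ⟨by omega⟩
  hasSum_unitS_SpureRecAt_of_letters hLc hr cE cVH cΛ (threeFace_SrecAt_zero_of_wilsonFace hLc hr cE cVH cΛ hW)
    (fun j k γ α β => LambdaPieceThreeFace.threeFace_SLam_lamCoeffK_eq_zero hLc hr j k γ α β) j sf sm κ a b s

end Wilson


/-! ## Everything from the ONE finite graded identity of the cubic Wilson table ((W-face), `WilsonThreeFaceGraded`) -/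

section Graded

variable {r : Fin (d + 1) → ℕ}

/-- NOT IN PRINT; OUR BOOKKEEPING.  **«3F-REC» AT EVERY LEVEL AND PERIOD FROM (W-face)** (`3 ≤ Lc`). -/
theorem threeFace_rec_of_gradedWilson (hLc : 3 ≤ Lc) (hr : r ∈ box (d + 1) Lc) (cE cVH cΛ : ℝ)
    (hG : ∀ (γ α β : Fin (d + 1)), ∑ x ∈ box1 (d + 1), ∑ z ∈ box1 (d + 1),
      (if ((α = γ → x α = 0) ∧ (β = γ → z β = 0) ∧ (α = β → α ≠ γ → x α = z β)) then
        wilsonA d γ 0 x z (Sum.inl α) (Sum.inl β) else 0) = 0)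
    (j k : ℕ) (γ α β : Fin (d + 1)) :
    ∑ v ∈ box (d + 1) (Lc ^ (k + 1)), (if toSite v γ % ((Lc ^ (k + 1) : ℕ) : ℤ) = ((Lc ^ (k + 1) : ℕ) : ℤ) - 1 then (1 : ℝ) else 0) *
        ∑' yw : Site (d + 1) × Site (d + 1),
          (if yw.1 α % ((Lc ^ (k + 1) : ℕ) : ℤ) = ((Lc ^ (k + 1) : ℕ) : ℤ) - 1 then (1 : ℝ) else 0) *
            (if yw.2 β % ((Lc ^ (k + 1) : ℕ) : ℤ) = ((Lc ^ (k + 1) : ℕ) : ℤ) - 1 then (1 : ℝ) else 0) *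
            SrecAt d Lc (toSite r) cE cVH cΛ j γ (toSite v) yw.1 yw.2 (Sum.inl α) (Sum.inl β) = 0 :=
  threeFace_rec_of_wilsonFace (le_trans (by norm_num) hLc) hr cE cVH cΛ
    (fun k γ α β => WilsonThreeFaceGraded.threeFace_wilsonA_of_graded hLc k γ α β (hG γ α β)) j k γ α β

/-- NOT IN PRINT; OUR BOOKKEEPING.  **«S3C-REC» (EVERY MEMBER, WITH VALUES) FROM (W-face)** (`3 ≤ Lc`). -/
theorem hasSum_unitS_SpureRecAt_of_gradedWilson (hLc : 3 ≤ Lc) (hr : r ∈ box (d + 1) Lc) (cE cVH cΛ : ℝ)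
    (hG : ∀ (γ α β : Fin (d + 1)), ∑ x ∈ box1 (d + 1), ∑ z ∈ box1 (d + 1),
      (if ((α = γ → x α = 0) ∧ (β = γ → z β = 0) ∧ (α = β → α ≠ γ → x α = z β)) then
        wilsonA d γ 0 x z (Sum.inl α) (Sum.inl β) else 0) = 0)
    (j : ℕ) (sf sm : ℝ) (κ a b : Fin (d + 1)) (s : Site (d + 1)) :
    HasSum (fun p : Site (d + 1) × Site (d + 1) =>
        unitS sf sm (SpureRecAt d Lc (toSite r) cE cVH cΛ j) κ s p.1 p.2 (Sum.inl a) (Sum.inl b)) 0 ∧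
      HasSum (fun p : Site (d + 1) × Site (d + 1) =>
        unitS sf sm (SpureRecAt d Lc (toSite r) cE cVH cΛ j) κ p.1 p.2 s (Sum.inl a) (Sum.inl b)) 0 ∧
      HasSum (fun p : Site (d + 1) × Site (d + 1) =>
        unitS sf sm (SpureRecAt d Lc (toSite r) cE cVH cΛ j) κ p.1 s p.2 (Sum.inl a) (Sum.inl b)) 0 :=
  hasSum_unitS_SpureRecAt_of_wilsonFace (le_trans (by norm_num) hLc) hr cE cVH cΛ
    (fun k γ α β => WilsonThreeFaceGraded.threeFace_wilsonA_of_graded hLc k γ α β (hG γ α β)) j sf sm κ a b s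

end Graded

end Summit.QuantumFields.BalabanUV.Beta.GAN24.ThreeFaceRecOfLetters

end
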